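import Summits.HodgeConjecture.CorCM.GaloisQuaternionCyclicPrimeNormPairs
import HarnessLib

/-!
# `μ₄`-norm-pair certificates: `Q₈ × C_p` is BAD for `p = 37, 43, 61`

COR-CM (cell `pub-hodgecm2`), binder seat b04 (gen 29), count-neutral claim QUATERNION-CYCLIC-PRIME-DEGENERATE — instances
of part II (`GaloisQuaternionCyclic.exists_simple_degenerate_of_normPair`): a Galois CM field `K` with `Gal(K/ℚ) ≅ Q₈ × C_p`
carries a simple DEGENERATE CM abelian `4p`-fold with a rational `(q,q)` class outside the divisor ring on some power as
soon as `ℤ/p` has a `μ₄`-norm pair `(k₀, k₁)` (sheets `kⱼ : ℤ/p → ℤ/4` for which `Σⱼ #{v : kⱼ(v) − kⱼ(d−v) =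
r}`-combinations do not depend on `d`); the certificate is two vectors in `(ℤ/4)^p`, checked by `decide +kernel` on `ℤ/p`
alone.  Pairs `p = 37` (`h = 3`) and `p = 61` (`h = 5`) from the seat's orbit-compressed meet-in-the-middle search (gen 29,
`scratch-g29/mitm.c`): both sheets constant on the cosets of an ODD-order multiplier group `H ≤ (ℤ/p)ˣ` (an even-order `H ∋
−1` can never carry a pair: then `Gⱼ ∈ ℚ(ζ + ζ⁻¹)(i)` and `−1 = N(G₀)/N(G₁)` would be a sum of two squares in the totally
real field `ℚ(ζ + ζ⁻¹)`); `1728 / 576` such pairs exist for `p = 37 / 61`, none for the odd-order classes of `p = 29, 41, 43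
(h = 7), 53, 59, 67 (h = 11), 101 (h = 25), 109 (h = 9, 27), …` — the BAD side of gen 25's dichotomy «`Q₈ × C_p` GOOD iff
`ord_p 2` odd» is now certified for `p = 3, 5, 11, 13, 17, 19, 37, 61`.  KERNEL ONLY: theorems; no definition, no named
fact, no `sorry`.  `HC_CM` is neither used nor claimed.

## References

* [Kubota1965] T. Kubota, *On the field extension by complex multiplication*, Trans. AMS 118 (1965), §2, §4 Lemma 2.
* [Shimura1998] G. Shimura, *Abelian Varieties with Complex Multiplication and Modular Functions*, §6.2 Thm. 3, §8.2 Prop. 26.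
* [Gordon1999HodgeAVSurvey] B. B. Gordon, *A survey of the Hodge conjecture for abelian varieties*, Thm. 6.4, §9.3.
-/

noncomputable section

open CategoryTheory CategoryTheory.Limits NumberField
open scoped BigOperators

namespace Summit.HodgeConjecture.CorCM.GaloisQuaternionCyclic

open Literature.NumberTheory.ComplexMultiplication
open Literature.AlgebraicGeometry.Motives (AbelianVariety CMType)
open Literature.AlgebraicGeometry.HodgeTheory
open Literature.AlgebraicGeometry.ComplexMultiplication (IsCMTypeRealisation)
open Literature.AlgebraicGeometry.Pohlmann1968
open Literature.Barriers.HodgeConjecture (divisorClassesSpan)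

variable {K : Type} [Field K] [NumberField K] [IsCMField K] [IsGalois ℚ K]

/-- **`Gal(K/ℚ) ≅ Q₈ × C_37` is BAD** (`ord_37 2` is even): the `μ₄`-norm pair `k₀ = [0, 0, 1, 3, 3, 1, 2, 2, 2, 1, 0, 2, 1, 1,
3, 1, 1, 1, 0, 1, 1, 0, 1, 2, 0, 0, 0, 2, 0, 3, 3, 3, 0, 2, 2, 1, 2]`, `k₁ = [0, 0, 1, 1, 1, 1, 2, 0, 2, 1, 0, 0, 1, 1, 3,
1, 1, 3, 2, 1, 1, 2, 3, 2, 2, 2, 0, 0, 2, 3, 1, 3, 2, 0, 0, 3, 0]` in `ℤ/37` (both sheets constant on the cosets of the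
subgroup of order `3` of `(ℤ/37)ˣ`) (in the proof `kⱼ(v)` is the `v`-th base-`4` digit of `Nⱼ = Σ_v kⱼ(v)·4^v`) gives a
simple DEGENERATE abelian `148`-fold with CM by `K` and a rational `(q,q)` class outside the divisor ring on some power.
[cite: Kubota1965, §4 Lemma 2] [cite: Shimura1998, §6.2 Thm. 3 and §8.2 Prop. 26] [cite: Gordon1999HodgeAVSurvey, Thm. 6.4
and §9.3] -/
theorem exists_simple_degenerate_quaternion_cyclic37_normPair
    (e : (K ≃ₐ[ℚ] K) ≃* QuaternionGroup 2 × Multiplicative (ZMod 37)) :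
    ∃ (Φ : CMType K) (φ₀ : K →+* ℂ) (A : AbelianVariety ℂ) (ι : 𝓞 K →+* End A)
      (θ : K →+* Module.End ℂ (complexBetti A.X 1)),
      IsPrimitive (ℂ ≃+* ℂ) Φ.1 φ₀ ∧ ¬ IsNondegenerate Φ ∧ IsCMTypeRealisation Φ A ι θ ∧ A.IsSimple ∧ A.dim = 148 ∧
      ∃ n q : ℕ, ∃ x : complexBetti (⨁ fun _ : Fin n => A).X (2 * q), IsRationalClass x ∧
        IsOfHodgeType (⨁ fun _ : Fin n => A).dim (⨁ fun _ : Fin n => A).X (2 * q) q q x ∧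
        x ∉ divisorClassesSpan (⨁ fun _ : Fin n => A).X (⨁ fun _ : Fin n => A).dim q := by
  -- the sheets are read off the base-`4` digits of two numerals: `decide +kernel` costs `O(1)` GMP operations per lookup
  obtain ⟨Φ, φ₀, A, ι, θ, h1, h2, h3, h4, h5, h6⟩ := @exists_simple_degenerate_of_normPair 37 ⟨by norm_num⟩ K _ _ _ _
    (by norm_num) e
    (fun v : ZMod 37 => (((11381389051627171129296 : ℕ) / 4 ^ v.val % 4 : ℕ) : ZMod 4))
    (fun v : ZMod 37 => (((3594668154805606032720 : ℕ) / 4 ^ v.val % 4 : ℕ) : ZMod 4))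
    ⟨2, by decide +kernel⟩ (by decide +kernel) (by decide +kernel)
  exact ⟨Φ, φ₀, A, ι, θ, h1, h2, h3, h4, by norm_num at h5; exact h5, h6⟩

/-- **`Gal(K/ℚ) ≅ Q₈ × C_43` is BAD** (`ord_43 2` is even): the `μ₄`-norm pair `k₀ = [0, 3, 2, 2, 0, 1, 3, 3, 1, 3, 2, 3, 2, 2,
1, 0, 2, 2, 2, 2, 1, 0, 2, 3, 0, 0, 0, 0, 2, 2, 1, 1, 1, 0, 1, 2, 3, 3, 2, 2, 0, 1, 3]`, `k₁ = [0, 1, 0, 2, 2, 1, 1, 1, 1,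
3, 0, 3, 0, 2, 3, 2, 0, 0, 2, 2, 1, 2, 2, 3, 2, 2, 0, 0, 2, 0, 1, 3, 1, 0, 1, 2, 1, 1, 2, 2, 2, 3, 1]` in `ℤ/43` (both
sheets constant on the cosets of the subgroup of order `3` of `(ℤ/43)ˣ`) (in the proof `kⱼ(v)` is the `v`-th base-`4` digit
of `Nⱼ = Σ_v kⱼ(v)·4^v`) gives a simple DEGENERATE abelian `172`-fold with CM by `K` and a rational `(q,q)` class outside
the divisor ring on some power. [cite: Kubota1965, §4 Lemma 2] [cite: Shimura1998, §6.2 Thm. 3 and §8.2 Prop. 26] [cite: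
Gordon1999HodgeAVSurvey, Thm. 6.4 and §9.3] -/
theorem exists_simple_degenerate_quaternion_cyclic43_normPair
    (e : (K ≃ₐ[ℚ] K) ≃* QuaternionGroup 2 × Multiplicative (ZMod 43)) :
    ∃ (Φ : CMType K) (φ₀ : K →+* ℂ) (A : AbelianVariety ℂ) (ι : 𝓞 K →+* End A)
      (θ : K →+* Module.End ℂ (complexBetti A.X 1)),
      IsPrimitive (ℂ ≃+* ℂ) Φ.1 φ₀ ∧ ¬ IsNondegenerate Φ ∧ IsCMTypeRealisation Φ A ι θ ∧ A.IsSimple ∧ A.dim = 172 ∧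
      ∃ n q : ℕ, ∃ x : complexBetti (⨁ fun _ : Fin n => A).X (2 * q), IsRationalClass x ∧
        IsOfHodgeType (⨁ fun _ : Fin n => A).dim (⨁ fun _ : Fin n => A).X (2 * q) q q x ∧
        x ∉ divisorClassesSpan (⨁ fun _ : Fin n => A).X (⨁ fun _ : Fin n => A).dim q := by
  -- the sheets are read off the base-`4` digits of two numerals: `decide +kernel` costs `O(1)` GMP operations per lookup
  obtain ⟨Φ, φ₀, A, ι, θ, h1, h2, h3, h4, h5, h6⟩ := @exists_simple_degenerate_of_normPair 43 ⟨by norm_num⟩ K _ _ _ _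
    (by norm_num) e
    (fun v : ZMod 43 => (((63693238017785177008108716 : ℕ) / 4 ^ v.val % 4 : ℕ) : ZMod 4))
    (fun v : ZMod 43 => (((37049654971169428822906500 : ℕ) / 4 ^ v.val % 4 : ℕ) : ZMod 4))
    ⟨1, by decide +kernel⟩ (by decide +kernel) (by decide +kernel)
  exact ⟨Φ, φ₀, A, ι, θ, h1, h2, h3, h4, by norm_num at h5; exact h5, h6⟩

/-- **`Gal(K/ℚ) ≅ Q₈ × C_61` is BAD** (`ord_61 2` is even): the `μ₄`-norm pair `k₀ = [0, 0, 2, 3, 1, 1, 3, 2, 2, 0, 0, 2, 3, 1,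
1, 1, 1, 0, 2, 1, 0, 3, 1, 1, 1, 3, 0, 3, 2, 0, 0, 0, 0, 1, 0, 0, 1, 2, 2, 1, 2, 3, 3, 3, 0, 1, 1, 3, 1, 1, 1, 0, 3, 1, 3,
2, 1, 3, 0, 3, 3]`, `k₁ = [0, 0, 0, 1, 3, 1, 3, 0, 0, 0, 2, 0, 1, 3, 3, 3, 3, 2, 0, 3, 0, 3, 3, 3, 3, 1, 2, 1, 0, 2, 2, 2,
2, 3, 0, 2, 3, 0, 0, 1, 0, 1, 1, 3, 2, 1, 1, 1, 1, 3, 3, 2, 1, 3, 3, 0, 3, 1, 0, 3, 1]` in `ℤ/61` (both sheets constant on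
the cosets of the subgroup of order `5` of `(ℤ/61)ˣ`) (in the proof `kⱼ(v)` is the `v`-th base-`4` digit of `Nⱼ = Σ_v
kⱼ(v)·4^v`) gives a simple DEGENERATE abelian `244`-fold with CM by `K` and a rational `(q,q)` class outside the divisor
ring on some power. [cite: Kubota1965, §4 Lemma 2] [cite: Shimura1998, §6.2 Thm. 3 and §8.2 Prop. 26] [cite:
Gordon1999HodgeAVSurvey, Thm. 6.4 and §9.3] -/
theorem exists_simple_degenerate_quaternion_cyclic61_normPair
    (e : (K ≃ₐ[ℚ] K) ≃* QuaternionGroup 2 × Multiplicative (ZMod 61)) :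
    ∃ (Φ : CMType K) (φ₀ : K →+* ℂ) (A : AbelianVariety ℂ) (ι : 𝓞 K →+* End A)
      (θ : K →+* Module.End ℂ (complexBetti A.X 1)),
      IsPrimitive (ℂ ≃+* ℂ) Φ.1 φ₀ ∧ ¬ IsNondegenerate Φ ∧ IsCMTypeRealisation Φ A ι θ ∧ A.IsSimple ∧ A.dim = 244 ∧
      ∃ n q : ℕ, ∃ x : complexBetti (⨁ fun _ : Fin n => A).X (2 * q), IsRationalClass x ∧
        IsOfHodgeType (⨁ fun _ : Fin n => A).dim (⨁ fun _ : Fin n => A).X (2 * q) q q x ∧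
        x ∉ divisorClassesSpan (⨁ fun _ : Fin n => A).X (⨁ fun _ : Fin n => A).dim q := by
  -- the sheets are read off the base-`4` digits of two numerals: `decide +kernel` costs `O(1)` GMP operations per lookup
  obtain ⟨Φ, φ₀, A, ι, θ, h1, h2, h3, h4, h5, h6⟩ := @exists_simple_degenerate_of_normPair 61 ⟨by norm_num⟩ K _ _ _ _
    (by norm_num) e
    (fun v : ZMod 61 => (((5055818254021653500575711858805356000 : ℕ) / 4 ^ v.val % 4 : ℕ) : ZMod 4))
    (fun v : ZMod 61 => (((2363747298614206667357975494313129792 : ℕ) / 4 ^ v.val % 4 : ℕ) : ZMod 4))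
    ⟨2, by decide +kernel⟩ (by decide +kernel) (by decide +kernel)
  exact ⟨Φ, φ₀, A, ι, θ, h1, h2, h3, h4, by norm_num at h5; exact h5, h6⟩

end Summit.HodgeConjecture.CorCM.GaloisQuaternionCyclic

end
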